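import Summits.QuantumAdvantage.QuantumAdvantage.Theorems.LinnikCubicClassGroupsDegreeOnePrimesEscapeClassShortIntervalDHPrimes
import HarnessLib

/-!
# Prime ideals of a class in short intervals with Deuring–Heilbronn, VI: the `θ_C`- and `π_C`-forms

Topic `Summits/QuantumAdvantage/QuantumAdvantage/Theorems`, cell B2b-1 (linnik-cubic), PART A (gen 19); helper
toward the crux `DegreeOnePrimesEscape` (stmt-QuantumAdvantage-11543) of route `LinnikCubicClassGroups`.
HONEST FRAMING: the value of this file is a THEOREM (kernel-checked, GRH-free, Siegel-free) — NOT summit progress.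

* `classTheta_shortInterval_dh` — the two-sided, Deuring–Heilbronn-sharp class prime number theorem in short
  intervals of the Linnik range in the `θ_C`-form `Σ_{𝔭 ∈ C prime, x < N𝔭 ≤ x+h} log N𝔭`: for `x ≥ Q^{a}`,
  `x^{1−δ} ≤ h ≤ x`, every class `C` of every number field of degree `n`:
  (A) `|h_K Δθ_C − h| ≤ κ h`; (B) `χ₁(C) = +1`: `|h_K Δθ_C − (h − I)| ≤ κ (h − I)`; `χ₁(C) = −1`:
  `|h_K Δθ_C − (h + I)| ≤ κ·min(1,(1−β₁)log x)·h` (`I = ∫_x^{x+h} t^{β₁−1}dt`);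
* `classPrimeCount_shortInterval_dh` — the `π_C`-form: the same three estimates for
  `h_K · #{𝔭 ∈ C prime : x < N𝔭 ≤ x+h} · log x`.
The prime powers and the variation of `log N𝔭` over `(x, x+h] ⊂ (x, 2x]` are absorbed into the RELATIVE error using
Stark's `1 − β₁ ≥ c₁Q^{−2}` (the flat main term is `≥ (h/2)·c₁Q^{−2}`).
References: G. Hoheisel (1930); [LagariasMontgomeryOdlyzko1979, §7]; [ThornerZaman2019, Thm. 3.1].
-/

noncomputable section

open Complex Real
open scoped NumberField nonZeroDivisors

namespace Summit.QuantumAdvantage.QuantumAdvantage.Theorems.DegreeOnePrimesEscape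

open Literature.NumberTheory.LFunctions Literature.NumberTheory.LFunctions.NumberField
  Literature.NumberTheory.LFunctions.AbelianDensity

/-! ### The `θ_C`-form -/

set_option maxHeartbeats 1600000 in
/-- **The class prime number theorem in short intervals, `θ_C`-form, two-sided, Deuring–Heilbronn-sharp, every class
of every number field of degree `n`** (see the module docstring).
[cite: LagariasMontgomeryOdlyzko1979, §7] [cite: ThornerZaman2019, Theorem 3.1] -/
theorem classTheta_shortInterval_dh (n : ℕ) (hn : 1 < n) {κ : ℝ} (hκ : 0 < κ) :
    ∃ δ a c : ℝ, 0 < δ ∧ δ ≤ 1 / 64 ∧ 1 ≤ a ∧ 0 < c ∧ c ≤ 1 / (8 * ((n : ℝ) ^ 2 + 1)) ∧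
    ∀ (K : Type) [Field K] [NumberField K], Module.finrank ℚ K = n →
      ∀ (C : ClassGroup (𝓞 K)) (x h : ℝ), ThornerZaman.condQn K ^ a ≤ x → x ^ (1 - δ) ≤ h → h ≤ x →
      ((¬ ∃ (χ₁ : ClassGroup (𝓞 K) →* ℂˣ) (β₁ : ℝ), χ₁ * χ₁ = 1 ∧ classGroupLFunction K χ₁ β₁ = 0 ∧
            1 - c / (Real.log ((NumberField.discr K).natAbs : ℝ) + Real.log 4) < β₁ ∧ β₁ < 1) →
          |(NumberField.classNumber K : ℝ) *
              (chebyshevThetaIdealClass K C (x + h) - chebyshevThetaIdealClass K C x) - h| ≤ κ * h) ∧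
      (∀ (χ₁ : ClassGroup (𝓞 K) →* ℂˣ) (β₁ : ℝ), χ₁ * χ₁ = 1 → classGroupLFunction K χ₁ β₁ = 0 →
          1 - c / (Real.log ((NumberField.discr K).natAbs : ℝ) + Real.log 4) < β₁ → β₁ < 1 →
          ((χ₁ C : ℂ) = 1 →
            |(NumberField.classNumber K : ℝ) *
                (chebyshevThetaIdealClass K C (x + h) - chebyshevThetaIdealClass K C x) -
                (h - ((x + h) ^ β₁ - x ^ β₁) / β₁)| ≤ κ * (h - ((x + h) ^ β₁ - x ^ β₁) / β₁)) ∧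
          ((χ₁ C : ℂ) = -1 →
            |(NumberField.classNumber K : ℝ) *
                (chebyshevThetaIdealClass K C (x + h) - chebyshevThetaIdealClass K C x) -
                (h + ((x + h) ^ β₁ - x ^ β₁) / β₁)| ≤ κ * min 1 ((1 - β₁) * Real.log x) * h)) := by
  obtain ⟨δ, a, c, hδ, hδ64, ha, hc, hcn, hmain⟩ := classPsi_shortInterval_dh n hn (half_pos hκ)
  obtain ⟨c₁, hc₁, hc₁1, heff⟩ := Residue.one_sub_realZero_ge_condQn_rpow n hn
  obtain ⟨a₂, ha₂, habs⟩ := absorb_junk (128 / (κ * c₁)) 1 (by positivity) one_pos le_rfl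
  refine ⟨δ, max a a₂, c, hδ, hδ64, le_max_of_le_left ha, hc, hcn, fun K _ _ hKn C x h hx hhx hhx' ↦ ?_⟩
  have hK : 1 < Module.finrank ℚ K := by rw [hKn]; exact hn
  set Q : ℝ := ThornerZaman.condQn K with hQ
  have hQ12 : (12 : ℝ) ≤ Q := ThornerZaman.twelve_le_condQn (K := K) hK
  have hQ1 : (1 : ℝ) ≤ Q := by linarith
  have hQ0 : (0 : ℝ) < Q := by linarith
  have hxa : Q ^ a ≤ x := (Real.rpow_le_rpow_of_exponent_le hQ1 (le_max_left _ _)).trans hx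
  have hxa₂ : Q ^ a₂ ≤ x := (Real.rpow_le_rpow_of_exponent_le hQ1 (le_max_right _ _)).trans hx
  have hQx : Q ≤ x := by
    have := (Real.rpow_le_rpow_of_exponent_le hQ1 (ha.trans (le_max_left a a₂))).trans hx
    rwa [Real.rpow_one] at this
  have hx1 : 1 ≤ x := by linarith
  have hx0 : 0 < x := by linarith
  have hh0 : 0 < h := lt_of_lt_of_le (Real.rpow_pos_of_pos hx0 _) hhx
  obtain ⟨hA, hB⟩ := hmain K hKn C x h hxa hhx hhx'
  obtain ⟨-, -, hlog12⟩ := log_small_consts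
  have hlogx : 1 ≤ Real.log x := by
    have := hlog12.trans (Real.log_le_log (by norm_num) (hQ12.trans hQx)); linarith
  -- the prime powers: `h_K |Δψ_C − Δθ_C| ≤ E ≤ (κc₁/8) Q^{-2} h`
  have hnQ : (Module.finrank ℚ K : ℝ) ≤ Q := ThornerZaman.finrank_le_condQn (K := K)
  have hhK : (NumberField.classNumber K : ℝ) ≤ Q ^ (4 : ℕ) := ThornerZaman.classNumber_le_condQn_pow (K := K) hK
  have hh1 : (0 : ℝ) ≤ (NumberField.classNumber K : ℝ) := Nat.cast_nonneg _
  have hpp1 := classPsi_sub_theta_le_sqrt (K := K) C (show (1 : ℝ) ≤ x + h by linarith)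
  have hpp0 := classPsi_sub_theta_le_sqrt (K := K) C hx1
  have hθψ1 := chebyshevThetaIdealClass_le_classPsi (K := K) C (x + h)
  have hθψ0 := chebyshevThetaIdealClass_le_classPsi (K := K) C x
  have hsqrt : Real.sqrt (x + h) ≤ 2 * x ^ ((1 : ℝ) / 2) := by
    rw [Real.sqrt_eq_rpow]
    have h1 : (x + h) ^ ((1 : ℝ) / 2) ≤ (4 * x) ^ ((1 : ℝ) / 2) :=
      Real.rpow_le_rpow (by linarith) (by linarith) (by norm_num)
    have h2 : (4 * x) ^ ((1 : ℝ) / 2) = 2 * x ^ ((1 : ℝ) / 2) := by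
      rw [Real.mul_rpow (by norm_num) hx0.le]
      congr 1
      rw [show (4 : ℝ) = 2 ^ (2 : ℕ) by norm_num, ← Real.rpow_natCast, ← Real.rpow_mul (by norm_num)]
      norm_num
    linarith
  have hsqrt0 : Real.sqrt x ≤ Real.sqrt (x + h) := Real.sqrt_le_sqrt (by linarith)
  have hlogxh : Real.log (x + h) ≤ Real.log x + 1 := by
    have h1 : Real.log (x + h) ≤ Real.log (2 * x) := Real.log_le_log (by linarith) (by linarith)
    rw [Real.log_mul (by norm_num) hx0.ne'] at h1
    have h2 : Real.log 2 < 0.6931471808 := Real.log_two_lt_d9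
    linarith
  have hlog0 : 0 ≤ Real.log x := Real.log_nonneg hx1
  have hlogxh0 : 0 ≤ Real.log (x + h) := Real.log_nonneg (by linarith)
  have hlogle : Real.log x ≤ Real.log (x + h) := Real.log_le_log hx0 (by linarith)
  have hl1 : 0 ≤ Real.log x + 1 := by linarith
  have hQm2 : 0 < Q ^ (-(2 : ℝ)) := Real.rpow_pos_of_pos hQ0 _
  have hQm2le : Q ^ (-(2 : ℝ)) ≤ 1 := Real.rpow_le_one_of_one_le_of_nonpos hQ1 (by norm_num)
  have hQ52 : Q ^ (5 : ℕ) = Q ^ (7 : ℕ) * Q ^ (-(2 : ℝ)) := by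
    rw [show (Q ^ (7 : ℕ) : ℝ) = Q ^ (7 : ℝ) from (Real.rpow_natCast Q 7).symm, ← Real.rpow_add hQ0,
      show (Q ^ (5 : ℕ) : ℝ) = Q ^ (5 : ℝ) from (Real.rpow_natCast Q 5).symm]
    norm_num
  have hx34 : x ^ ((1 : ℝ) / 2) = x ^ (-((1 : ℝ) / 4)) * x ^ ((3 : ℝ) / 4) := by
    rw [← Real.rpow_add hx0]; norm_num
  have hx34h : x ^ ((3 : ℝ) / 4) ≤ h := (Real.rpow_le_rpow_of_exponent_le hx1 (by linarith)).trans hhx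
  have habs' := habs Q x hQ12 hxa₂
  -- `E := h_K · 2·(2n√(x+h) log(x+h)) ≤ (κ c₁/8) Q^{-2} h`
  set E : ℝ := (NumberField.classNumber K : ℝ) * (2 * (2 * Module.finrank ℚ K * Real.sqrt (x + h) * Real.log (x + h)))
    with hE
  have hEle : E ≤ κ * c₁ / 8 * Q ^ (-(2 : ℝ)) * h := by
    have hA' : 8 * Q ^ (7 : ℕ) * (Real.log x + 1) * x ^ ((1 : ℝ) / 2) ≤ κ * c₁ / 8 * h := by
      rw [hx34]
      calc 8 * Q ^ (7 : ℕ) * (Real.log x + 1) * (x ^ (-((1 : ℝ) / 4)) * x ^ ((3 : ℝ) / 4))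
          = (κ * c₁ / 16) * ((128 / (κ * c₁)) * Q ^ (7 : ℕ) * (Real.log x + 1) * x ^ (-((1 : ℝ) / 4))) *
              x ^ ((3 : ℝ) / 4) := by field_simp; ring
        _ ≤ (κ * c₁ / 16) * 1 * h := mul_le_mul (mul_le_mul_of_nonneg_left habs' (by positivity)) hx34h
            (by positivity) (by positivity)
        _ ≤ κ * c₁ / 8 * h := by nlinarith [mul_pos (mul_pos hκ hc₁) hh0]
    calc E ≤ Q ^ (4 : ℕ) * (2 * (2 * Q * (2 * x ^ ((1 : ℝ) / 2)) * (Real.log x + 1))) := by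
          rw [hE]
          refine mul_le_mul hhK (mul_le_mul_of_nonneg_left (mul_le_mul (mul_le_mul (by linarith) hsqrt
            (Real.sqrt_nonneg _) (by positivity)) hlogxh hlogxh0 (by positivity))
            (by norm_num)) (by positivity) (by positivity)
      _ = 8 * Q ^ (5 : ℕ) * (Real.log x + 1) * x ^ ((1 : ℝ) / 2) := by ring
      _ = (8 * Q ^ (7 : ℕ) * (Real.log x + 1) * x ^ ((1 : ℝ) / 2)) * Q ^ (-(2 : ℝ)) := by rw [hQ52]; ring
      _ ≤ (κ * c₁ / 8 * h) * Q ^ (-(2 : ℝ)) := mul_le_mul_of_nonneg_right hA' hQm2.le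
      _ = κ * c₁ / 8 * Q ^ (-(2 : ℝ)) * h := by ring
  -- `|h_K Δθ − h_K Δψ| ≤ E`
  have hdiff : |(NumberField.classNumber K : ℝ) *
      (chebyshevThetaIdealClass K C (x + h) - chebyshevThetaIdealClass K C x) -
      (NumberField.classNumber K : ℝ) * (classPsi K C (x + h) - classPsi K C x)| ≤ E := by
    have hpp0' : classPsi K C x - chebyshevThetaIdealClass K C x ≤
        2 * Module.finrank ℚ K * Real.sqrt (x + h) * Real.log (x + h) :=
      hpp0.trans (mul_le_mul (mul_le_mul_of_nonneg_left hsqrt0 (by positivity)) hlogle hlog0 (by positivity))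
    rw [abs_le, hE]
    constructor <;> nlinarith [mul_le_mul_of_nonneg_left hpp1 hh1, mul_le_mul_of_nonneg_left hpp0' hh1,
      mul_le_mul_of_nonneg_left hθψ1 hh1, mul_le_mul_of_nonneg_left hθψ0 hh1]
  have hc₁Q1 : c₁ * Q ^ (-(2 : ℝ)) ≤ 1 := (mul_le_mul hc₁1 hQm2le hQm2.le zero_le_one).trans (by norm_num)
  have hEκh : E ≤ κ / 2 * h := by
    refine hEle.trans ?_
    have := mul_le_mul_of_nonneg_right hc₁Q1 (by positivity : (0 : ℝ) ≤ κ / 8 * h)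
    nlinarith [mul_pos hκ hh0]
  refine ⟨fun hno ↦ ?_, fun χ₁ β₁ hreal hLz hwin hβ1 ↦ ⟨fun hC ↦ ?_, fun hC ↦ ?_⟩⟩
  · have key := hA hno
    have := abs_sub_le ((NumberField.classNumber K : ℝ) *
      (chebyshevThetaIdealClass K C (x + h) - chebyshevThetaIdealClass K C x))
      ((NumberField.classNumber K : ℝ) * (classPsi K C (x + h) - classPsi K C x)) h
    linarith
  · obtain ⟨hflat, -⟩ := hB χ₁ β₁ hreal hLz hwin hβ1
    have key := hflat hC
    have hβhalf : 1 / 2 ≤ β₁ := half_le_of_window (N := K) (n₀ := n) hcn hwin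
    have hfl := half_min_mul_le_flat hx1 hh0.le (by linarith) hβ1
    have hδlow : c₁ * Q ^ (-(2 : ℝ)) ≤ 1 - β₁ := heff K hKn χ₁ hreal β₁ hβ1 hLz
    have hμ : c₁ * Q ^ (-(2 : ℝ)) ≤ min 1 ((1 - β₁) * Real.log x) := by
      refine le_min hc₁Q1 (hδlow.trans ?_)
      exact le_mul_of_one_le_right (by linarith) hlogx
    have hEM : E ≤ κ / 2 * (h - ((x + h) ^ β₁ - x ^ β₁) / β₁) := by
      refine hEle.trans ?_
      have h1 : κ * c₁ / 8 * Q ^ (-(2 : ℝ)) * h ≤ κ / 4 * (h / 2 * min 1 ((1 - β₁) * Real.log x)) := by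
        have := mul_le_mul_of_nonneg_right hμ (by positivity : (0 : ℝ) ≤ κ / 8 * h)
        nlinarith
      nlinarith [mul_le_mul_of_nonneg_left hfl (by positivity : (0 : ℝ) ≤ κ / 4)]
    have := abs_sub_le ((NumberField.classNumber K : ℝ) *
      (chebyshevThetaIdealClass K C (x + h) - chebyshevThetaIdealClass K C x))
      ((NumberField.classNumber K : ℝ) * (classPsi K C (x + h) - classPsi K C x)) (h - ((x + h) ^ β₁ - x ^ β₁) / β₁)
    linarith
  · obtain ⟨-, hplus⟩ := hB χ₁ β₁ hreal hLz hwin hβ1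
    have key := hplus hC
    have hδlow : c₁ * Q ^ (-(2 : ℝ)) ≤ 1 - β₁ := heff K hKn χ₁ hreal β₁ hβ1 hLz
    have hμ : c₁ * Q ^ (-(2 : ℝ)) ≤ min 1 ((1 - β₁) * Real.log x) := by
      refine le_min hc₁Q1 (hδlow.trans ?_)
      exact le_mul_of_one_le_right (by linarith) hlogx
    have hEM : E ≤ κ / 2 * min 1 ((1 - β₁) * Real.log x) * h := by
      refine hEle.trans ?_
      have := mul_le_mul_of_nonneg_right hμ (by positivity : (0 : ℝ) ≤ κ / 8 * h)
      nlinarith [mul_pos hκ hh0]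
    have := abs_sub_le ((NumberField.classNumber K : ℝ) *
      (chebyshevThetaIdealClass K C (x + h) - chebyshevThetaIdealClass K C x))
      ((NumberField.classNumber K : ℝ) * (classPsi K C (x + h) - classPsi K C x)) (h + ((x + h) ^ β₁ - x ^ β₁) / β₁)
    linarith

/-! ### The `π_C`-form -/

/-- `(π_C(x+h) − π_C(x)) · log x ≤ θ_C(x+h) − θ_C(x)` (`1 ≤ x`, `0 ≤ h`): every new prime has norm `> x`. [folklore] -/
theorem count_sub_mul_log_le_chebyshevThetaIdealClass_sub {K : Type} [Field K] [NumberField K]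
    (C : ClassGroup (𝓞 K)) {x h : ℝ} (hx : 1 ≤ x) (hh : 0 ≤ h) :
    ((primeIdealClassCount K C (x + h) : ℝ) - primeIdealClassCount K C x) * Real.log x ≤
      chebyshevThetaIdealClass K C (x + h) - chebyshevThetaIdealClass K C x := by
  classical
  have hx0 : (0 : ℝ) ≤ x := by linarith
  have hxh0 : (0 : ℝ) ≤ x + h := by linarith
  set S := (finite_primeIdealsInClassLE (K := K) C x).toFinset with hS
  set T := (finite_primeIdealsInClassLE (K := K) C (x + h)).toFinset with hT
  have hST : S ⊆ T := by
    intro P hP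
    rw [hS, Set.Finite.mem_toFinset] at hP
    rw [hT, Set.Finite.mem_toFinset]
    obtain ⟨h1, h2, h3⟩ := hP
    exact ⟨h1, h2.trans (by linarith), h3⟩
  rw [chebyshevThetaIdealClass_eq_sum_primeIdealsInClassLE K C hxh0, chebyshevThetaIdealClass_eq_sum_primeIdealsInClassLE
    K C hx0, ← hS, ← hT, primeIdealClassCount, primeIdealClassCount,
    Set.ncard_eq_toFinset_card _ (finite_primeIdealsInClassLE C (x + h)),
    Set.ncard_eq_toFinset_card _ (finite_primeIdealsInClassLE C x), ← hS, ← hT,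
    ← Finset.sum_sdiff hST, add_sub_cancel_right]
  have hcard : ((T \ S).card : ℝ) = (T.card : ℝ) - S.card := by
    rw [Finset.card_sdiff_of_subset hST, Nat.cast_sub (Finset.card_le_card hST)]
  rw [← hcard]
  have h := Finset.card_nsmul_le_sum (T \ S) (fun P : Ideal (𝓞 K) ↦ Real.log (Ideal.absNorm P : ℝ))
    (Real.log x) (fun P hP ↦ ?_)
  · rwa [nsmul_eq_mul] at h
  · rw [Finset.mem_sdiff, hT, Set.Finite.mem_toFinset, hS, Set.Finite.mem_toFinset] at hP
    obtain ⟨⟨hPr, hle, hP0, hPC⟩, hnot⟩ := hP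
    have hxP : x < (Ideal.absNorm P : ℝ) := by
      by_contra hle'
      rw [not_lt] at hle'
      exact hnot ⟨hPr, hle', hP0, hPC⟩
    exact Real.log_le_log (by linarith) hxP.le

set_option maxHeartbeats 1600000 in
/-- **The class prime number theorem in short intervals, `π_C`-form**: for `n > 1`, `κ > 0` there are
`δ ∈ (0,1/64]`, `a ≥ 1`, `c > 0` such that for every number field `K` of degree `n`, every class `C`, every
`x ≥ Q^{a}` and `x^{1−δ} ≤ h ≤ x`, with `N = #{𝔭 ∈ C prime : x < N𝔭 ≤ x + h}` and `I = ∫_x^{x+h} t^{β₁−1}dt`: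
(A) no exceptional zero ⇒ `|h_K N log x − h| ≤ κ h`; (B) `χ₁(C) = +1` ⇒ `|h_K N log x − (h − I)| ≤ κ (h − I)`
(relative, Deuring–Heilbronn); `χ₁(C) = −1` ⇒ `|h_K N log x − (h + I)| ≤ κ h`.
[cite: LagariasMontgomeryOdlyzko1979, §7] [cite: ThornerZaman2019, Theorem 3.1] -/
theorem classPrimeCount_shortInterval_dh (n : ℕ) (hn : 1 < n) {κ : ℝ} (hκ : 0 < κ) :
    ∃ δ a c : ℝ, 0 < δ ∧ δ ≤ 1 / 64 ∧ 1 ≤ a ∧ 0 < c ∧ c ≤ 1 / (8 * ((n : ℝ) ^ 2 + 1)) ∧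
    ∀ (K : Type) [Field K] [NumberField K], Module.finrank ℚ K = n →
      ∀ (C : ClassGroup (𝓞 K)) (x h : ℝ), ThornerZaman.condQn K ^ a ≤ x → x ^ (1 - δ) ≤ h → h ≤ x →
      ((¬ ∃ (χ₁ : ClassGroup (𝓞 K) →* ℂˣ) (β₁ : ℝ), χ₁ * χ₁ = 1 ∧ classGroupLFunction K χ₁ β₁ = 0 ∧
            1 - c / (Real.log ((NumberField.discr K).natAbs : ℝ) + Real.log 4) < β₁ ∧ β₁ < 1) →
          |(NumberField.classNumber K : ℝ) *
              ((primeIdealClassCount K C (x + h) : ℝ) - primeIdealClassCount K C x) * Real.log x - h| ≤ κ * h) ∧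
      (∀ (χ₁ : ClassGroup (𝓞 K) →* ℂˣ) (β₁ : ℝ), χ₁ * χ₁ = 1 → classGroupLFunction K χ₁ β₁ = 0 →
          1 - c / (Real.log ((NumberField.discr K).natAbs : ℝ) + Real.log 4) < β₁ → β₁ < 1 →
          ((χ₁ C : ℂ) = 1 →
            |(NumberField.classNumber K : ℝ) *
                ((primeIdealClassCount K C (x + h) : ℝ) - primeIdealClassCount K C x) * Real.log x -
                (h - ((x + h) ^ β₁ - x ^ β₁) / β₁)| ≤ κ * (h - ((x + h) ^ β₁ - x ^ β₁) / β₁)) ∧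
          ((χ₁ C : ℂ) = -1 →
            |(NumberField.classNumber K : ℝ) *
                ((primeIdealClassCount K C (x + h) : ℝ) - primeIdealClassCount K C x) * Real.log x -
                (h + ((x + h) ^ β₁ - x ^ β₁) / β₁)| ≤ κ * h)) := by
  -- `θ`-form at precision `κ' = min(κ,1)/4`, and `log 2/log x ≤ κ'` from `x ≥ Q^{a}`, `a ≥ 1/κ'`
  set κ' : ℝ := min κ 1 / 4 with hκ'
  have hκ'0 : 0 < κ' := by rw [hκ']; exact div_pos (lt_min hκ one_pos) (by norm_num)
  have hκ'κ : κ' ≤ κ / 4 := by rw [hκ']; exact div_le_div_of_nonneg_right (min_le_left _ _) (by norm_num)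
  have hκ'1 : κ' ≤ 1 / 4 := by rw [hκ']; exact div_le_div_of_nonneg_right (min_le_right _ _) (by norm_num)
  obtain ⟨δ, a, c, hδ, hδ64, ha, hc, hcn, hmain⟩ := classTheta_shortInterval_dh n hn hκ'0
  refine ⟨δ, max a (1 / κ'), c, hδ, hδ64, le_max_of_le_left ha, hc, hcn, fun K _ _ hKn C x h hx hhx hhx' ↦ ?_⟩
  have hK : 1 < Module.finrank ℚ K := by rw [hKn]; exact hn
  set Q : ℝ := ThornerZaman.condQn K with hQ
  have hQ12 : (12 : ℝ) ≤ Q := ThornerZaman.twelve_le_condQn (K := K) hK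
  have hQ1 : (1 : ℝ) ≤ Q := by linarith
  have hxa : Q ^ a ≤ x := (Real.rpow_le_rpow_of_exponent_le hQ1 (le_max_left _ _)).trans hx
  have hQx : Q ≤ x := by
    have := (Real.rpow_le_rpow_of_exponent_le hQ1 (ha.trans (le_max_left a _))).trans hx
    rwa [Real.rpow_one] at this
  have hx1 : 1 ≤ x := by linarith
  have hx0 : 0 < x := by linarith
  have hh0 : 0 < h := lt_of_lt_of_le (Real.rpow_pos_of_pos hx0 _) hhx
  obtain ⟨-, -, hlog12⟩ := log_small_consts
  have hlogQ : 2 ≤ Real.log Q := hlog12.trans (Real.log_le_log (by norm_num) hQ12)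
  -- `log 2 ≤ κ' log x`
  have hlogx : 1 / κ' * Real.log Q ≤ Real.log x := by
    have h1 := Real.log_le_log (Real.rpow_pos_of_pos (by linarith) _) hx
    rw [Real.log_rpow (by linarith)] at h1
    exact le_trans (mul_le_mul_of_nonneg_right (le_max_right _ _) (by linarith)) h1
  have hlog2 : Real.log 2 < 0.6931471808 := Real.log_two_lt_d9
  have hρκ : Real.log 2 ≤ κ' * Real.log x := by
    have : κ' * (1 / κ' * Real.log Q) = Real.log Q := by field_simp
    have h2 := mul_le_mul_of_nonneg_left hlogx hκ'0.le
    linarith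
  have hlogx0 : 0 < Real.log x := Real.log_pos (by linarith)
  -- `N log x ∈ [Δθ − N·log 2, Δθ]`, `N ≤ Δθ / log x`
  set N : ℝ := (primeIdealClassCount K C (x + h) : ℝ) - primeIdealClassCount K C x with hN
  set Δθ : ℝ := chebyshevThetaIdealClass K C (x + h) - chebyshevThetaIdealClass K C x with hΔθ
  have hlo := count_sub_mul_log_le_chebyshevThetaIdealClass_sub C hx1 hh0.le
  have hup := chebyshevThetaIdealClass_sub_le_count_sub_mul_log C hx1 hh0.le
  rw [← hN, ← hΔθ] at hlo hup
  have hlogxh : Real.log (x + h) ≤ Real.log x + Real.log 2 := by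
    have h1 : Real.log (x + h) ≤ Real.log (2 * x) := Real.log_le_log (by linarith) (by linarith)
    rw [Real.log_mul (by norm_num) hx0.ne'] at h1; linarith
  have hN0 : 0 ≤ N := by
    rw [hN, sub_nonneg]; exact_mod_cast primeIdealClassCount_mono (K := K) C (by linarith : x ≤ x + h)
  have hNΔ : N * Real.log x ≤ Δθ := hlo
  have hΔN : Δθ ≤ N * Real.log x + N * (κ' * Real.log x) := by
    have := mul_le_mul_of_nonneg_left (hlogxh.trans (by linarith : Real.log x + Real.log 2 ≤ Real.log x + κ' * Real.log x)) hN0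
    linarith
  -- so `h_K N log x ≥ h_K Δθ/(1+κ') ≥ h_K Δθ (1 − κ')`
  set hKr : ℝ := (NumberField.classNumber K : ℝ) with hhKr
  have hhK0 : 0 ≤ hKr := Nat.cast_nonneg _
  have hsand : hKr * Δθ - κ' * (hKr * Δθ) ≤ hKr * N * Real.log x ∧ hKr * N * Real.log x ≤ hKr * Δθ := by
    constructor
    · -- `Δθ ≤ N log x (1 + κ')` ⇒ `Δθ (1 − κ') ≤ Δθ/(1+κ') ≤ N log x`
      have h1 : Δθ ≤ N * Real.log x * (1 + κ') := by linarith
      have h2 : Δθ - κ' * Δθ ≤ N * Real.log x := by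
        have hΔ0 : 0 ≤ Δθ := le_trans (mul_nonneg hN0 hlogx0.le) hNΔ
        nlinarith [mul_nonneg hN0 hlogx0.le]
      have := mul_le_mul_of_nonneg_left h2 hhK0
      linarith
    · have := mul_le_mul_of_nonneg_left hNΔ hhK0; linarith
  obtain ⟨hA, hB⟩ := hmain K hKn C x h hxa hhx hhx'
  refine ⟨fun hno ↦ ?_, fun χ₁ β₁ hreal hLz hwin hβ1 ↦ ⟨fun hC ↦ ?_, fun hC ↦ ?_⟩⟩
  · have key := abs_le.1 (hA hno)
    rw [← hΔθ] at key
    have hΔup : hKr * Δθ ≤ (1 + κ') * h := by linarith [key.2]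
    rw [abs_le]; constructor <;> nlinarith [hsand.1, hsand.2, key.1, key.2, mul_pos hκ hh0]
  · obtain ⟨hflat, -⟩ := hB χ₁ β₁ hreal hLz hwin hβ1
    have key := abs_le.1 (hflat hC)
    rw [← hΔθ] at key
    set M : ℝ := h - ((x + h) ^ β₁ - x ^ β₁) / β₁ with hM
    have hβhalf : 1 / 2 ≤ β₁ := half_le_of_window (N := K) (n₀ := n) hcn hwin
    have hM0 : 0 ≤ M := by
      have hfl := half_min_mul_le_flat hx1 hh0.le (by linarith) hβ1
      have : 0 ≤ min 1 ((1 - β₁) * Real.log x) :=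
        le_min zero_le_one (mul_nonneg (by linarith) (Real.log_nonneg hx1))
      rw [hM]; nlinarith
    have hΔup : hKr * Δθ ≤ (1 + κ') * M := by linarith [key.2]
    rw [abs_le]; constructor <;> nlinarith [hsand.1, hsand.2, key.1, key.2, mul_nonneg hκ.le hM0]
  · obtain ⟨-, hplus⟩ := hB χ₁ β₁ hreal hLz hwin hβ1
    have key := abs_le.1 (hplus hC)
    rw [← hΔθ] at key
    have hβhalf : 1 / 2 ≤ β₁ := half_le_of_window (N := K) (n₀ := n) hcn hwin
    have hmin0 : 0 ≤ min 1 ((1 - β₁) * Real.log x) :=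
      le_min zero_le_one (mul_nonneg (by linarith) (Real.log_nonneg hx1))
    have hmin1 : min 1 ((1 - β₁) * Real.log x) ≤ 1 := min_le_left _ _
    have hI0 : 0 ≤ ((x + h) ^ β₁ - x ^ β₁) / β₁ := by
      refine div_nonneg ?_ (by linarith)
      have := Real.rpow_le_rpow hx0.le (show x ≤ x + h by linarith) (by linarith : 0 ≤ β₁)
      linarith
    have hIh : ((x + h) ^ β₁ - x ^ β₁) / β₁ ≤ h := by
      have h1 := rpow_window_div_le hx0 hh0.le (by linarith : 0 < β₁) hβ1.le
      have h2 : x ^ (β₁ - 1) ≤ 1 := Real.rpow_le_one_of_one_le_of_nonpos hx1 (by linarith)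
      have h3 := mul_le_mul_of_nonneg_left h2 hh0.le
      linarith
    have hκμ : κ' * min 1 ((1 - β₁) * Real.log x) * h ≤ κ' * h := by nlinarith [mul_pos hκ'0 hh0]
    have hΔup : hKr * Δθ ≤ 2 * h + κ' * h := by linarith [key.2]
    rw [abs_le]; constructor <;> nlinarith [hsand.1, hsand.2, key.1, key.2, mul_pos hκ hh0]

end Summit.QuantumAdvantage.QuantumAdvantage.Theorems.DegreeOnePrimesEscape

end
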